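import Summits.Ventures.CertifiedManyBodySolver.Upper.UMPSDualBound
import HarnessLib

/-!
# uMPS dual certificates: bridge lemmas for the assembly (entries, Kronecker words, bond reindexing)

HONEST FRAMING: first certified bounds; not a superconductivity verdict; every number certified or
labelled float.

Companion of `Upper/UMPSDualBound.lean` (the tensor-side telescoping bound). Small algebra used by
the assembly `Upper/UMPSEnergyBound.lean` to match the Jordan–Wigner image of the open Hubbard chain
(`JordanWigner.toSpin_hamiltonian_pathGraph`: a double sum `Σ_i Σ_j [i+1 = j]` of products
`onSite i M₁ · onSite j M₂`) with the `bondSum`/`twoSiteOp` vocabulary of the telescoping bound: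

* `twoSiteOp_apply`, `onSite_mul_onSite_apply` — entries;
* `twoSiteOp_kronecker` — `twoSiteOp N j (M₁ ⊗ₖ M₂) = onSite j M₁ · onSite (j+1) M₂`,
  `twoSiteOp_kronecker_one`, `bondSum_kronecker`;
* linearity `twoSiteOp_add/_smul/_sum`, `bondSum_add/_smul/_sum`;
* `sum_sum_ite_val_succ_eq` — `Σ_i Σ_j [i.val + 1 = j.val] g i j = Σ_{x : Fin (n+1)} g x (x+1)` on
  `Fin (n+2)`.

Theorems only; nothing here is a claim about the Hubbard model.
-/

noncomputable section

open Matrix Finset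
open scoped ComplexOrder BigOperators

namespace Summit.Ventures.CertifiedManyBodySolver.Upper

open Literature.MathematicalPhysics.QuantumLattice

variable {q D : ℕ}

open scoped Kronecker

/-- A single-site operator is the linear combination of the placed matrix units:
`onSite x M = Σ_{a b} M_{ab} • onSite x E_{ab}`. -/
theorem onSite_eq_sum_single {N : ℕ} (x : Fin N) (M : Matrix (Fin q) (Fin q) ℂ) :
    (onSite x M : Op (Fin N) q) = ∑ a : Fin q, ∑ b : Fin q, M a b • onSite x (Matrix.single a b (1 : ℂ)) := by
  ext σ τ
  simp only [onSite_apply, Matrix.sum_apply, Matrix.smul_apply, smul_eq_mul]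
  by_cases h : ∀ y, y ≠ x → σ y = τ y
  · simp only [if_pos h]
    have hs : ∀ a b : Fin q, (Matrix.single a b (1 : ℂ)) (σ x) (τ x) =
        if a = σ x ∧ b = τ x then 1 else 0 := fun _ _ => rfl
    simp only [hs, mul_ite, mul_one, mul_zero]
    rw [Finset.sum_eq_single (σ x)]
    · rw [Finset.sum_eq_single (τ x)]
      · rw [if_pos ⟨rfl, rfl⟩]
      · intro b _ hb
        rw [if_neg (fun h' => hb h'.2)]
      · intro h'
        exact absurd (Finset.mem_univ _) h'
    · intro a _ ha
      exact Finset.sum_eq_zero fun b _ => by rw [if_neg (fun h' => ha h'.1)]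
    · intro h'
      exact absurd (Finset.mem_univ _) h'
  · simp only [if_neg h, mul_zero, Finset.sum_const_zero]

/-- `twoSiteOp` is additive in the two-site matrix. -/
theorem twoSiteOp_add (N j : ℕ) (hj : j + 1 < N) (X X' : Matrix (Fin q × Fin q) (Fin q × Fin q) ℂ) :
    (twoSiteOp N j hj (X + X') : Op (Fin N) q) = twoSiteOp N j hj X + twoSiteOp N j hj X' := by
  simp only [twoSiteOp, Matrix.add_apply, add_smul, Finset.sum_add_distrib]

/-- `twoSiteOp` commutes with scalars. -/
theorem twoSiteOp_smul (N j : ℕ) (hj : j + 1 < N) (c : ℂ) (X : Matrix (Fin q × Fin q) (Fin q × Fin q) ℂ) :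
    (twoSiteOp N j hj (c • X) : Op (Fin N) q) = c • twoSiteOp N j hj X := by
  simp only [twoSiteOp, Matrix.smul_apply, smul_eq_mul, mul_smul, Finset.smul_sum]

/-- `twoSiteOp` of a finite sum. -/
theorem twoSiteOp_sum {ι : Type*} (s : Finset ι) (N j : ℕ) (hj : j + 1 < N)
    (X : ι → Matrix (Fin q × Fin q) (Fin q × Fin q) ℂ) :
    (twoSiteOp N j hj (∑ i ∈ s, X i) : Op (Fin N) q) = ∑ i ∈ s, twoSiteOp N j hj (X i) := by
  classical
  induction s using Finset.induction_on with
  | empty =>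
    simp only [Finset.sum_empty, twoSiteOp, Matrix.zero_apply, zero_smul, Finset.sum_const_zero]
  | insert i s hi ih => rw [Finset.sum_insert hi, Finset.sum_insert hi, twoSiteOp_add, ih]

/-- Entries of a product of two single-site operators at distinct sites:
`⟨σ| onSite x A · onSite y B |τ⟩ = A (σ x) (τ x) · B (σ y) (τ y)` if `σ = τ` off `{x, y}`, else `0`. -/
theorem onSite_mul_onSite_apply {N : ℕ} {x y : Fin N} (hxy : x ≠ y) (A B : Matrix (Fin q) (Fin q) ℂ)
    (σ τ : TensorIndex (Fin N) q) :
    (onSite x A * onSite y B : Op (Fin N) q) σ τ =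
      if (∀ z, z ≠ x → z ≠ y → σ z = τ z) then A (σ x) (τ x) * B (σ y) (τ y) else 0 := by
  rw [onSite_mul_onSite_eq_productOp hxy, productOp_apply,
    ← Finset.mul_prod_erase Finset.univ _ (Finset.mem_univ x),
    ← Finset.mul_prod_erase (Finset.univ.erase x) _ (Finset.mem_erase.2 ⟨hxy.symm, Finset.mem_univ y⟩),
    Function.update_self, Function.update_of_ne hxy.symm, Function.update_self]
  have hrest : ∏ z ∈ (Finset.univ.erase x).erase y,
      Function.update (Function.update (fun _ => (1 : Matrix (Fin q) (Fin q) ℂ)) y B) x A z (σ z) (τ z) =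
      if (∀ z, z ≠ x → z ≠ y → σ z = τ z) then 1 else 0 := by
    rw [Finset.prod_congr rfl (g := fun z => if σ z = τ z then (1 : ℂ) else 0)]
    · rw [Finset.prod_boole]
      by_cases h : ∀ z, z ≠ x → z ≠ y → σ z = τ z
      · rw [if_pos h, if_pos]
        intro z hz
        rw [Finset.mem_erase, Finset.mem_erase] at hz
        exact h z hz.2.1 hz.1
      · rw [if_neg h, if_neg]
        intro h'
        exact h fun z hzx hzy => h' z (Finset.mem_erase.2 ⟨hzy, Finset.mem_erase.2 ⟨hzx, Finset.mem_univ z⟩⟩)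
    · intro z hz
      rw [Finset.mem_erase, Finset.mem_erase] at hz
      rw [Function.update_of_ne hz.2.1, Function.update_of_ne hz.1, Matrix.one_apply]
  rw [hrest]
  split_ifs <;> ring

/-- **Entries of `twoSiteOp`.** `⟨σ| X_{j,j+1} |τ⟩ = X_{(σ_j,σ_{j+1}),(τ_j,τ_{j+1})}` if `σ = τ` off
the bond, else `0`. -/
theorem twoSiteOp_apply (N j : ℕ) (hj : j + 1 < N) (X : Matrix (Fin q × Fin q) (Fin q × Fin q) ℂ)
    (σ τ : TensorIndex (Fin N) q) :
    twoSiteOp N j hj X σ τ =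
      if (∀ z, z ≠ (⟨j, by omega⟩ : Fin N) → z ≠ (⟨j + 1, hj⟩ : Fin N) → σ z = τ z) then
        X (σ ⟨j, by omega⟩, σ ⟨j + 1, hj⟩) (τ ⟨j, by omega⟩, τ ⟨j + 1, hj⟩) else 0 := by
  have hjN : j < N := by omega
  have hne : (⟨j, hjN⟩ : Fin N) ≠ ⟨j + 1, hj⟩ := fun h => by
    have := congrArg Fin.val h
    simp at this
  rw [show (⟨j, by omega⟩ : Fin N) = ⟨j, hjN⟩ from rfl]
  simp only [twoSiteOp, Matrix.sum_apply, Matrix.smul_apply, smul_eq_mul,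
    onSite_mul_onSite_apply hne]
  by_cases h : ∀ z, z ≠ (⟨j, hjN⟩ : Fin N) → z ≠ (⟨j + 1, hj⟩ : Fin N) → σ z = τ z
  · simp only [if_pos h]
    have hs : ∀ (a b i i' : Fin q), (Matrix.single a b (1 : ℂ)) i i' = if a = i ∧ b = i' then 1 else 0 :=
      fun _ _ _ _ => rfl
    simp only [hs, mul_ite, mul_one, mul_zero]
    rw [Finset.sum_eq_single (σ ⟨j, hjN⟩, σ ⟨j + 1, hj⟩)]
    · rw [Finset.sum_eq_single (τ ⟨j, hjN⟩, τ ⟨j + 1, hj⟩)]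
      · simp
      · intro p' _ hp'
        by_cases ho : (σ ⟨j, hjN⟩, σ ⟨j + 1, hj⟩).2 = σ ⟨j + 1, hj⟩ ∧ p'.2 = τ ⟨j + 1, hj⟩
        · rw [if_pos ho, if_neg (fun hc => hp' (Prod.ext hc.2 ho.2))]
        · rw [if_neg ho]
      · intro h'
        exact absurd (Finset.mem_univ _) h'
    · intro p _ hp
      refine Finset.sum_eq_zero fun p' _ => ?_
      by_cases ho : p.2 = σ ⟨j + 1, hj⟩ ∧ p'.2 = τ ⟨j + 1, hj⟩
      · rw [if_pos ho, if_neg (fun hc => hp (Prod.ext hc.1 ho.1))]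
      · rw [if_neg ho]
    · intro h'
      exact absurd (Finset.mem_univ _) h'
  · simp [if_neg h]

/-- **Kronecker words.** The two-site matrix `M₁ ⊗ₖ M₂` placed on the bond `(j, j+1)` is the
product of the single-site operators: `twoSiteOp N j (M₁ ⊗ₖ M₂) = onSite j M₁ · onSite (j+1) M₂`. -/
theorem twoSiteOp_kronecker (N j : ℕ) (hj : j + 1 < N) (M₁ M₂ : Matrix (Fin q) (Fin q) ℂ) :
    (twoSiteOp N j hj (M₁ ⊗ₖ M₂) : Op (Fin N) q) =
      onSite (⟨j, by omega⟩ : Fin N) M₁ * onSite (⟨j + 1, hj⟩ : Fin N) M₂ := by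
  have hjN : j < N := by omega
  have hne : (⟨j, hjN⟩ : Fin N) ≠ ⟨j + 1, hj⟩ := fun h => by
    have := congrArg Fin.val h
    simp at this
  ext σ τ
  rw [twoSiteOp_apply, show (⟨j, by omega⟩ : Fin N) = ⟨j, hjN⟩ from rfl, onSite_mul_onSite_apply hne,
    Matrix.kroneckerMap_apply]

/-- A Kronecker word with the identity on the right is a single-site operator on the left site. -/
theorem twoSiteOp_kronecker_one (N j : ℕ) (hj : j + 1 < N) (M : Matrix (Fin q) (Fin q) ℂ) :
    (twoSiteOp N j hj (M ⊗ₖ (1 : Matrix (Fin q) (Fin q) ℂ)) : Op (Fin N) q) =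
      onSite (⟨j, by omega⟩ : Fin N) M := by
  rw [twoSiteOp_kronecker, onSite_one', mul_one]

/-- `bondSum` is additive. -/
theorem bondSum_add (n : ℕ) (X X' : Matrix (Fin q × Fin q) (Fin q × Fin q) ℂ) :
    (bondSum n (X + X') : Op (Fin (n + 2)) q) = bondSum n X + bondSum n X' := by
  simp only [bondSum, twoSiteOp_add, Finset.sum_add_distrib]

/-- `bondSum` commutes with scalars. -/
theorem bondSum_smul (n : ℕ) (c : ℂ) (X : Matrix (Fin q × Fin q) (Fin q × Fin q) ℂ) :
    (bondSum n (c • X) : Op (Fin (n + 2)) q) = c • bondSum n X := by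
  simp only [bondSum, twoSiteOp_smul, Finset.smul_sum]

/-- `bondSum` of a finite sum. -/
theorem bondSum_sum {ι : Type*} (s : Finset ι) (n : ℕ)
    (X : ι → Matrix (Fin q × Fin q) (Fin q × Fin q) ℂ) :
    (bondSum n (∑ i ∈ s, X i) : Op (Fin (n + 2)) q) = ∑ i ∈ s, bondSum n (X i) := by
  simp only [bondSum, twoSiteOp_sum]
  rw [Finset.sum_comm]

/-- `bondSum` of a Kronecker word: `Σ_{j ≤ n} onSite j M₁ · onSite (j+1) M₂`. -/
theorem bondSum_kronecker (n : ℕ) (M₁ M₂ : Matrix (Fin q) (Fin q) ℂ) :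
    (bondSum n (M₁ ⊗ₖ M₂) : Op (Fin (n + 2)) q) =
      ∑ j : Fin (n + 1), onSite (⟨j, by omega⟩ : Fin (n + 2)) M₁ * onSite (⟨j + 1, by omega⟩ : Fin (n + 2)) M₂ := by
  simp only [bondSum, twoSiteOp_kronecker]

/-- **Bond reindexing.** A double sum over ordered nearest-neighbour pairs `(i, j)`, `i + 1 = j`,
of the chain `Fin (n+2)` is a sum over the `n + 1` bonds. -/
theorem sum_sum_ite_val_succ_eq {M : Type*} [AddCommMonoid M] (n : ℕ) (g : Fin (n + 2) → Fin (n + 2) → M) :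
    (∑ i : Fin (n + 2), ∑ j : Fin (n + 2), if i.val + 1 = j.val then g i j else 0) =
      ∑ x : Fin (n + 1), g ⟨x, by omega⟩ ⟨x + 1, by omega⟩ := by
  have hinner : ∀ i : Fin (n + 2), (∑ j : Fin (n + 2), if i.val + 1 = j.val then g i j else 0) =
      if h : i.val + 1 < n + 2 then g i ⟨i.val + 1, h⟩ else 0 := by
    intro i
    by_cases h : i.val + 1 < n + 2
    · rw [dif_pos h, Finset.sum_eq_single (⟨i.val + 1, h⟩ : Fin (n + 2))]
      · rw [if_pos rfl]
      · intro j _ hj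
        rw [if_neg]
        intro hij
        exact hj (Fin.ext hij.symm)
      · intro h'
        exact absurd (Finset.mem_univ _) h'
    · rw [dif_neg h]
      refine Finset.sum_eq_zero fun j _ => ?_
      rw [if_neg]
      intro hij
      exact h (hij ▸ j.isLt)
  simp only [hinner]
  rw [Fin.sum_univ_castSucc]
  have hlast : ¬ ((Fin.last (n + 1) : Fin (n + 2)).val + 1 < n + 2) := by simp
  rw [dif_neg hlast, add_zero]
  refine Finset.sum_congr rfl fun x _ => ?_
  rw [dif_pos (by simp; omega)]
  rfl

end Summit.Ventures.CertifiedManyBodySolver.Upper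

end
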